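import Mathlib
import Summits.PneNP.PneNP.Theorems.CnfIdealGenLengthRankDefectRepresentationsCutLemma

/-!
# Crux `RankDefectRepresentations` (stmt-PneNP-18923), line `rank-dehn-ladder`: the NON-DEGENERATE TENSOR-NETWORK REGIME of
# CORE-LINEAR (lead g13, memo `Cruxes/RankDefectRepresentations/Lines/rank-dehn-ladder-g13.md` §5b(iii))

Setting of the registered tool stub `stub_coreLinear` in abstract colours: rows `x` carry an I-colour `rI x : α` and a J-colour
`rJ x : β`, columns likewise (`cI`, `cJ`); a cell is VISIBLE iff both colours differ; wanted is a matrix of small rank agreeing with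
`D` at the visible cells.  The memo's ROWS-AND-COLUMNS criterion (§5b) says that simultaneous correction of the row- and column-regions is
equivalent to a two-layer factorisation ("bi-dictionary" / tensor network)

  `D[x, y] = ξ_x · C(rJ x, cJ y) · ω_yᵀ`   at the visible cells,   `ξ_x, ω_y ∈ K^w`,  `C(a,b) ∈ K^{w×w}`,

and CORE-LINEAR is the same with `C(a,b)` independent of `(a,b)`.  THIS FILE proves that the factorisation alone already forces a cheap
completion as soon as the legs are NON-DEGENERATE on two distinct I-classes:

  `completion_of_tensorNetwork`: if the legs of the rows of I-class `i₀` are jointly injective (for every J-colour `a` the vectors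
  `ξ_x`, `x` of type `(i₀,a)`, span `K^w`), the legs of the columns of an I-class `i₁ ≠ i₀` likewise, and the rectangles
  `(rows (i₀, J ∈ T)) × (columns (i₁, J ∉ T))` all have rank `≤ c`, then a matrix of rank `≤ 8c` agrees with `D` at every visible cell.

Proof: those rectangles are `Ξ₀ · 𝐂[T;Tᶜ] · Ω₁ᵀ` with injective `Ξ₀`, `Ω₁`, so the assembled core `𝐂 = (C(a,b))` — a ONE-family instance on
`β × Fin w` coloured by the first coordinate — has all cuts `≤ c` (`rank_coreCut_le`); g7's one-family max-cut decomposition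
(`…CutLemma.exists_blockDiagonal_of_maxCut`, p642852) corrects its diagonal blocks to rank `≤ 8c`, and pushing the corrected core through
ALL legs gives the completion.  Consequently every twist of a tensor-network instance of width `w` needs DEGENERATE legs (an I-class whose
rows of some J-colour do not span `K^w`) — rank drops again, as in g11's anchors, g12's frames and the cross fill of the memo §4.
Two small rank tools (`rank_mul_eq_of_mulVec_injective`, `rank_mul_transpose_eq_of_mulVec_injective`) are proved here; the core
`𝐂` and the leg matrices are written out as `Matrix.of` terms (no new definitions).
HONEST FRAMING: a proved linear REGIME (structural hypothesis), not the stub; the crux and P ≠ NP are not touched; F-N2 is a FRONTIER formal rung.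
-/

set_option linter.dupNamespace false -- `Summit.PneNP.PneNP.…`: summit = sub-problem name (D-0017)

namespace Summit.PneNP.PneNP.Theorems.CnfIdealGenLengthRankDefectRepresentationsTensorNetworkRegime

open Matrix Finset
open Summit.PneNP.PneNP.Theorems.CnfIdealGenLengthRankDefectRepresentationsCutLemma (exists_blockDiagonal_of_maxCut)

variable {K : Type} [Field K]

section RankTools

variable {l m n : Type} [Fintype m] [Fintype n]

/-- Left multiplication by a matrix with injective `mulVec` (independent columns) preserves the rank. -/
theorem rank_mul_eq_of_mulVec_injective (A : Matrix l m K) (M : Matrix m n K)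
    (hA : Function.Injective A.mulVec) : (A * M).rank = M.rank := by
  unfold Matrix.rank
  rw [Matrix.mulVecLin_mul, LinearMap.range_comp]
  have hinj : Function.Injective A.mulVecLin := hA
  exact (LinearEquiv.finrank_eq (Submodule.equivMapOfInjective _ hinj _)).symm

/-- Right multiplication by the transpose of a matrix with injective `mulVec` preserves the rank. -/
theorem rank_mul_transpose_eq_of_mulVec_injective [Fintype l] (M : Matrix l m K) (B : Matrix n m K)
    (hB : Function.Injective B.mulVec) : (M * Bᵀ).rank = M.rank := by
  rw [← Matrix.rank_transpose, Matrix.transpose_mul, Matrix.transpose_transpose,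
    rank_mul_eq_of_mulVec_injective B Mᵀ hB, Matrix.rank_transpose]

end RankTools

variable {ι ι' α β : Type} [Fintype ι] [Fintype ι'] [Fintype β] [DecidableEq α] [DecidableEq β] {w : ℕ}

omit [Fintype ι] [Fintype ι'] in
/-- Entries of `legs · core · legsᵀ`: row `x` and column `y` read the block `(rJ x, cJ y)` of the core through their legs. -/
theorem leg_mul_apply (rJ : ι → β) (cJ : ι' → β) (ξ : ι → Fin w → K) (ω : ι' → Fin w → K)
    (P : ι → Prop) (Q : ι' → Prop) [DecidablePred P] [DecidablePred Q]
    (M : Matrix (β × Fin w) (β × Fin w) K) (x : ι) (y : ι') :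
    ((Matrix.of fun x (p : β × Fin w) => if P x ∧ rJ x = p.1 then ξ x p.2 else 0) * M * ((Matrix.of fun y (p : β × Fin w) => if Q y ∧ cJ y = p.1 then ω y p.2 else 0))ᵀ) x y =
      if P x ∧ Q y then ∑ u, (∑ s, ξ x s * M (rJ x, s) (cJ y, u)) * ω y u else 0 := by
  classical
  have hin : ∀ q : β × Fin w, ((Matrix.of fun x (p : β × Fin w) => if P x ∧ rJ x = p.1 then ξ x p.2 else 0) * M) x q = if P x then ∑ s, ξ x s * M (rJ x, s) q else 0 := by
    intro q
    simp only [Matrix.mul_apply, Matrix.of_apply]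
    rw [Fintype.sum_prod_type]
    by_cases hP : P x
    · simp only [hP, true_and, if_true]
      rw [Finset.sum_eq_single (rJ x)]
      · simp
      · intro b _ hb
        simp [Ne.symm hb]
      · intro h
        exact absurd (Finset.mem_univ _) h
    · simp [hP]
  rw [Matrix.mul_apply]
  simp_rw [hin, Matrix.transpose_apply, Matrix.of_apply]
  rw [Fintype.sum_prod_type]
  by_cases hP : P x
  · by_cases hQ : Q y
    · simp only [hP, hQ, if_true, true_and, and_self]
      rw [Finset.sum_eq_single (cJ y)]
      · simp
      · intro b _ hb
        simp [Ne.symm hb]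
      · intro h
        exact absurd (Finset.mem_univ _) h
    · simp [hP, hQ]
  · simp [hP]

/-- Cut blocks of the assembled core are read by the non-degenerate legs: the rectangle (rows of I-class `i₀` with J-colour in `T`) ×
(columns of I-class `i₁` with J-colour outside `T`) of `D` equals `Ξ₀ · 𝐂[T;Tᶜ] · Ω₁ᵀ`, hence has the SAME rank as the core cut. -/
theorem rank_coreCut_le (rI : ι → α) (rJ : ι → β) (cI : ι' → α) (cJ : ι' → β)
    (ξ : ι → Fin w → K) (ω : ι' → Fin w → K) (C : β → β → Matrix (Fin w) (Fin w) K) (D : Matrix ι ι' K)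
    (hD : ∀ x y, rI x ≠ cI y → rJ x ≠ cJ y → D x y = ∑ u, (∑ s, ξ x s * C (rJ x) (cJ y) s u) * ω y u)
    (i₀ i₁ : α) (h01 : i₀ ≠ i₁)
    (hξ : Function.Injective ((Matrix.of fun x (p : β × Fin w) => if rI x = i₀ ∧ rJ x = p.1 then ξ x p.2 else 0)).mulVec)
    (hω : Function.Injective ((Matrix.of fun y (p : β × Fin w) => if cI y = i₁ ∧ cJ y = p.1 then ω y p.2 else 0)).mulVec)
    (T : Finset β) (c : ℕ)
    (hc : (Matrix.of fun x y => if (rI x = i₀ ∧ rJ x ∈ T) ∧ (cI y = i₁ ∧ cJ y ∉ T) then D x y else 0).rank ≤ c) :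
    (Matrix.of fun p q : β × Fin w => if p.1 ∈ T ∧ q.1 ∉ T then (Matrix.of fun p q : β × Fin w => C p.1 q.1 p.2 q.2) p q else 0).rank ≤ c := by
  classical
  set CT : Matrix (β × Fin w) (β × Fin w) K := Matrix.of fun p q => if p.1 ∈ T ∧ q.1 ∉ T then (Matrix.of fun p q : β × Fin w => C p.1 q.1 p.2 q.2) p q else 0 with hCT
  have hfac : (Matrix.of fun x y => if (rI x = i₀ ∧ rJ x ∈ T) ∧ (cI y = i₁ ∧ cJ y ∉ T) then D x y else 0) =
      (Matrix.of fun x (p : β × Fin w) => if rI x = i₀ ∧ rJ x = p.1 then ξ x p.2 else 0) * CT * ((Matrix.of fun y (p : β × Fin w) => if cI y = i₁ ∧ cJ y = p.1 then ω y p.2 else 0))ᵀ := by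
    ext x y
    rw [leg_mul_apply, Matrix.of_apply]
    by_cases h0 : rI x = i₀
    · by_cases h1 : cI y = i₁
      · simp only [h0, h1, true_and, and_self, if_true]
        by_cases hT : rJ x ∈ T ∧ cJ y ∉ T
        · rw [if_pos hT]
          have hI : rI x ≠ cI y := by rw [h0, h1]; exact h01
          have hJ : rJ x ≠ cJ y := fun e => hT.2 (e ▸ hT.1)
          rw [hD x y hI hJ]
          refine Finset.sum_congr rfl fun u _ => ?_
          congr 1
          refine Finset.sum_congr rfl fun s _ => ?_
          simp [hCT, hT]
        · rw [if_neg hT]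
          symm
          refine Finset.sum_eq_zero fun u _ => ?_
          rw [Finset.sum_eq_zero fun s _ => ?_, zero_mul]
          simp [hCT, hT]
      · simp [h1]
    · simp [h0]
  have hr : ((Matrix.of fun x (p : β × Fin w) => if rI x = i₀ ∧ rJ x = p.1 then ξ x p.2 else 0) * CT * ((Matrix.of fun y (p : β × Fin w) => if cI y = i₁ ∧ cJ y = p.1 then ω y p.2 else 0))ᵀ).rank = CT.rank := by
    rw [rank_mul_transpose_eq_of_mulVec_injective _ _ hω, rank_mul_eq_of_mulVec_injective _ _ hξ]
  rw [← hr, ← hfac]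
  exact hc

/-- **THE NON-DEGENERATE TENSOR-NETWORK REGIME.**  A two-layer factorisation `D[x,y] = ξ_x · C(rJ x, cJ y) · ω_yᵀ` at the visible cells,
with the row legs of some I-class `i₀` and the column legs of some other I-class `i₁` jointly injective, and the `(i₀, T) × (i₁, Tᶜ)`
rectangles of rank `≤ c` for every set `T` of J-colours, forces a completion of rank `≤ 8c`. -/
theorem completion_of_tensorNetwork (rI : ι → α) (rJ : ι → β) (cI : ι' → α) (cJ : ι' → β)
    (ξ : ι → Fin w → K) (ω : ι' → Fin w → K) (C : β → β → Matrix (Fin w) (Fin w) K) (D : Matrix ι ι' K)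
    (hD : ∀ x y, rI x ≠ cI y → rJ x ≠ cJ y → D x y = ∑ u, (∑ s, ξ x s * C (rJ x) (cJ y) s u) * ω y u)
    (i₀ i₁ : α) (h01 : i₀ ≠ i₁)
    (hξ : Function.Injective ((Matrix.of fun x (p : β × Fin w) => if rI x = i₀ ∧ rJ x = p.1 then ξ x p.2 else 0)).mulVec)
    (hω : Function.Injective ((Matrix.of fun y (p : β × Fin w) => if cI y = i₁ ∧ cJ y = p.1 then ω y p.2 else 0)).mulVec)
    (c : ℕ)
    (hc : ∀ T : Finset β,
      (Matrix.of fun x y => if (rI x = i₀ ∧ rJ x ∈ T) ∧ (cI y = i₁ ∧ cJ y ∉ T) then D x y else 0).rank ≤ c) :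
    ∃ L : Matrix ι ι' K, L.rank ≤ 8 * c ∧ ∀ x y, rI x ≠ cI y → rJ x ≠ cJ y → L x y = D x y := by
  classical
  -- cut function of the core and a maximiser
  let f : Finset β → ℕ := fun B =>
    (Matrix.of fun p q : β × Fin w => if p.1 ∈ B ∧ q.1 ∉ B then (Matrix.of fun p q : β × Fin w => C p.1 q.1 p.2 q.2) p q else 0).rank +
      (Matrix.of fun p q : β × Fin w => if p.1 ∉ B ∧ q.1 ∈ B then (Matrix.of fun p q : β × Fin w => C p.1 q.1 p.2 q.2) p q else 0).rank
  obtain ⟨B, -, hB⟩ := Finset.exists_max_image (univ : Finset (Finset β)) f univ_nonempty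
  have hfB : f B ≤ 2 * c := by
    have h1 := rank_coreCut_le rI rJ cI cJ ξ ω C D hD i₀ i₁ h01 hξ hω B c (hc B)
    have h2 := rank_coreCut_le rI rJ cI cJ ξ ω C D hD i₀ i₁ h01 hξ hω (univ \ B) c (hc (univ \ B))
    have hrev : (Matrix.of fun p q : β × Fin w => if p.1 ∉ B ∧ q.1 ∈ B then (Matrix.of fun p q : β × Fin w => C p.1 q.1 p.2 q.2) p q else 0) =
        (Matrix.of fun p q : β × Fin w => if p.1 ∈ univ \ B ∧ q.1 ∉ univ \ B then (Matrix.of fun p q : β × Fin w => C p.1 q.1 p.2 q.2) p q else 0) := by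
      ext p q
      simp only [Matrix.of_apply, mem_sdiff, mem_univ, true_and, not_not]
    change (Matrix.of fun p q : β × Fin w => if p.1 ∈ B ∧ q.1 ∉ B then (Matrix.of fun p q : β × Fin w => C p.1 q.1 p.2 q.2) p q else 0).rank +
      (Matrix.of fun p q : β × Fin w => if p.1 ∉ B ∧ q.1 ∈ B then (Matrix.of fun p q : β × Fin w => C p.1 q.1 p.2 q.2) p q else 0).rank ≤ 2 * c
    rw [hrev]
    omega
  obtain ⟨R', hsupp, hrank⟩ := exists_blockDiagonal_of_maxCut (K := K) Prod.fst Prod.fst ((Matrix.of fun p q : β × Fin w => C p.1 q.1 p.2 q.2)) B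
    (fun B' => hB B' (mem_univ _))
  refine ⟨(Matrix.of fun x (p : β × Fin w) => if True ∧ rJ x = p.1 then ξ x p.2 else 0) * ((Matrix.of fun p q : β × Fin w => C p.1 q.1 p.2 q.2) - R') * ((Matrix.of fun y (p : β × Fin w) => if True ∧ cJ y = p.1 then ω y p.2 else 0))ᵀ, ?_, ?_⟩
  · calc ((Matrix.of fun x (p : β × Fin w) => if True ∧ rJ x = p.1 then ξ x p.2 else 0) * ((Matrix.of fun p q : β × Fin w => C p.1 q.1 p.2 q.2) - R') * ((Matrix.of fun y (p : β × Fin w) => if True ∧ cJ y = p.1 then ω y p.2 else 0))ᵀ).rank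
        ≤ ((Matrix.of fun x (p : β × Fin w) => if True ∧ rJ x = p.1 then ξ x p.2 else 0) * ((Matrix.of fun p q : β × Fin w => C p.1 q.1 p.2 q.2) - R')).rank := Matrix.rank_mul_le_left _ _
      _ ≤ ((Matrix.of fun p q : β × Fin w => C p.1 q.1 p.2 q.2) - R').rank := Matrix.rank_mul_le_right _ _
      _ ≤ 4 * f B := hrank
      _ ≤ 8 * c := by omega
  · intro x y hI hJ
    rw [leg_mul_apply, if_pos ⟨trivial, trivial⟩, hD x y hI hJ]
    refine Finset.sum_congr rfl fun u _ => ?_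
    congr 1
    refine Finset.sum_congr rfl fun s _ => ?_
    have h0 : R' (rJ x, s) (cJ y, u) = 0 := hsupp _ _ (by simpa using hJ)
    simp [Matrix.sub_apply, h0]

end Summit.PneNP.PneNP.Theorems.CnfIdealGenLengthRankDefectRepresentationsTensorNetworkRegime
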